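import Summits.AtomisticToContinuum.Crystallization.Theorems.ChartedPlanarOrderDoorLayeredNear

/-!
# «DoorLayered» part C of 3 (§3 the split beneath L1′ in the BD currency — `NearHomL2BD`, K_A²_BD, K_B²_BD, calibration, the EXACT
# variant `DoorPeriodic`; §4 the split beneath BULK|door — `PeriodicBulkGapDoor`, kernels, `gap_and_pert_1_50_of_periodic`; §5 interface with
# lens-2: `NearHomBulkGapDenseBD`, `bulkDoor_of_homBD`, `gap_and_pert_1_50_of_homBD`) — lens-3 g22 node `DoorLayered.lean` (sha256 8d27d62f…,
# 972 l) split at the 400-line cap by hand-2 g8 (critic row 407 (3)); namespace `…Theorems.ChartedPlanarOrderDoorLayered` UNCHANGED;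
# parts A (`…DoorLayeredExact`, §1 + the node's full module text) and B (`…DoorLayeredNear`, §2) are imported.
-/

noncomputable section

open MeasureTheory Set Metric
open Summit.AtomisticToContinuum.Crystallization.Theorems.ChartedPlanarOrderRigidityDoor
open Summit.AtomisticToContinuum.Crystallization.Theorems.ChartedPlanarOrderDensityDichotomy
open Summit.AtomisticToContinuum.Crystallization.Theorems.ChartedPlanarOrderMesoCut
open Summit.AtomisticToContinuum.Crystallization.Theorems.OverbindingBudgetLiouvilleDictionary
  (NearHomBD not_nearHomBD_singleton nearHom_of_nearHomBD norm_triangularVec₁_one countable_of_isSep)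
open Literature.MathematicalPhysics.StatisticalMechanics (triangularVec₁ triangularVec₂)

namespace Summit.AtomisticToContinuum.Crystallization.Theorems.ChartedPlanarOrderDoorLayered

/-! ## 3. The split beneath L1′ in the currency of record (critic row 399 (3)): K_A²_BD ∧ K_B²_BD — and the EXACT variant K_B²♮ -/

/-- **NearHomL2BD Λ κ r S Q** — `Q` is near ONE layered structure in MEAN SQUARE under a chart of distortion `≤ Λ` (the tree currency's chart
clause verbatim: `L : E3 ≃L[ℝ] E3`, `‖L‖ ≤ Λ`, `‖L⁻¹‖ ≤ Λ`): a deviation profile `τ ≥ 0` with `EnvClose (τ x) r` at every `x ∈ Q` and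
`∑_{x∈Q} τ x² ≤ κ·#Q` (g21 `NearHomL2`, re-typed). -/
def NearHomL2BD (Λ κ r : ℝ) (S Q : Set E3) : Prop :=
  ∃ (L : E3 ≃L[ℝ] E3), ‖(L : E3 →L[ℝ] E3)‖ ≤ Λ ∧ ‖(L.symm : E3 →L[ℝ] E3)‖ ≤ Λ ∧
    ∃ (w : ℤ → E3) (Ψ : E3 → E3) (τ : E3 → ℝ), Set.InjOn Ψ Q ∧ Set.MapsTo Ψ Q (LayeredHom (L : E3 →L[ℝ] E3) w) ∧
      (∀ x ∈ Q, 0 ≤ τ x ∧ EnvClose (τ x) r S x (LayeredHom (L : E3 →L[ℝ] E3) w) (Ψ x)) ∧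
      ∑ᶠ x ∈ Q, τ x ^ 2 ≤ κ * nK Q

/-- `∑ᶠ_{p ∈ s} c = c · #s` in `ℝ` (for infinite `s` both sides vanish). -/
theorem finsum_mem_const_real (s : Set E3) (c : ℝ) : ∑ᶠ _p ∈ s, c = c * (s.ncard : ℝ) := by
  rcases s.finite_or_infinite with hs | hs
  · rw [finsum_mem_eq_finite_toFinset_sum _ hs, Finset.sum_const, nsmul_eq_mul, Set.ncard_eq_toFinset_card s hs, mul_comm]
  · rw [hs.ncard, Nat.cast_zero, mul_zero]
    by_cases hc : c = 0
    · simp [hc]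
    · exact finsum_mem_eq_zero_of_infinite (by simpa [Function.support_const hc] using hs)

/-- sup ⇒ mean square (constant profile): the currency of record feeds the L² currency. -/
theorem nearHomL2BD_of_nearHomBD {Λ τ r : ℝ} (hτ : 0 ≤ τ) {S Q : Set E3} (h : NearHomBD Λ τ r S Q) : NearHomL2BD Λ (τ ^ 2) r S Q := by
  obtain ⟨L, hL, hL', w, Ψ, hinj, hmaps, henv⟩ := h
  refine ⟨L, hL, hL', w, Ψ, fun _ => τ, hinj, hmaps, fun x hx => ⟨hτ, henv x hx⟩, ?_⟩
  rw [finsum_mem_const_real, nK]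

/-- monotonicity in the threshold. -/
theorem nearHomL2BD_mono {Λ κ κ' r : ℝ} (hκ : κ ≤ κ') {S Q : Set E3} (h : NearHomL2BD Λ κ r S Q) : NearHomL2BD Λ κ' r S Q := by
  obtain ⟨L, hL, hL', w, Ψ, τ, hinj, hmaps, hτ, hsum⟩ := h
  exact ⟨L, hL, hL', w, Ψ, τ, hinj, hmaps, hτ, hsum.trans (mul_le_mul_of_nonneg_right hκ (nK_nonneg Q))⟩

/-- one term of a finite sum of squares is below the sum. -/
theorem sq_le_finsum_mem {Q : Set E3} (hQ : Q.Finite) (τ : E3 → ℝ) {x : E3} (hx : x ∈ Q) :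
    τ x ^ 2 ≤ ∑ᶠ y ∈ Q, τ y ^ 2 := by
  rw [finsum_mem_eq_finite_toFinset_sum _ hQ]
  exact Finset.single_le_sum (f := fun y => τ y ^ 2) (fun y _ => sq_nonneg (τ y)) (hQ.mem_toFinset.2 hx)

/-- **mean square ⇒ sup on a FINITE chunk** with the crude tolerance `√(κ·#Q)`: the L² currency at chunk level is a GENUINE restriction exactly when
the sup currency is — so (w1)(w2) transfer. -/
theorem nearHomBD_of_nearHomL2BD {Λ κ r : ℝ} {S Q : Set E3} (hQ : Q.Finite) (h : NearHomL2BD Λ κ r S Q) :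
    NearHomBD Λ (Real.sqrt (κ * nK Q)) r S Q := by
  obtain ⟨L, hL, hL', w, Ψ, τ, hinj, hmaps, hτ, hsum⟩ := h
  refine ⟨L, hL, hL', w, Ψ, hinj, hmaps, fun x hx => envClose_mono ?_ (hτ x hx).2⟩
  have h1 : τ x ^ 2 ≤ κ * nK Q := (sq_le_finsum_mem hQ τ hx).trans hsum
  calc τ x = Real.sqrt (τ x ^ 2) := (Real.sqrt_sq (hτ x hx).1).symm
    _ ≤ Real.sqrt (κ * nK Q) := Real.sqrt_le_sqrt h1

/-- **(w1) for the L² currency**: an isolated atom is not `(Λ, κ, r)`-near-homogeneous in mean square once `Λ ≤ r` and `Λ² κ < 1`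
(lens-4's `not_nearHomBD_singleton`, transferred). -/
theorem not_nearHomL2BD_singleton {Λ κ r : ℝ} (hΛr : Λ ≤ r) (hκ : 0 ≤ κ) (hΛκ : Λ ^ 2 * κ < 1) (x : E3) :
    ¬ NearHomL2BD Λ κ r {x} {x} := by
  intro h
  have h1 := nearHomBD_of_nearHomL2BD (Set.finite_singleton x) h
  have hn : nK ({x} : Set E3) = 1 := by simp [nK]
  rw [hn, mul_one] at h1
  refine not_nearHomBD_singleton hΛr ?_ x h1
  -- `Λ √κ < 1`
  rcases le_or_gt Λ 0 with hΛ | hΛ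
  · exact lt_of_le_of_lt (mul_nonpos_of_nonpos_of_nonneg hΛ (Real.sqrt_nonneg κ)) one_pos
  · have : Λ * Real.sqrt κ = Real.sqrt (Λ ^ 2 * κ) := by
      rw [Real.sqrt_mul' _ hκ, Real.sqrt_sq hΛ.le]
    rw [this, show (1:ℝ) = Real.sqrt 1 from Real.sqrt_one.symm]
    exact Real.sqrt_lt_sqrt (by positivity) (by simpa using hΛκ)

/-- **(w2) for the L² currency**: the two-plane two-patch chunk is not near-homogeneous in mean square once `8 Λ³ √(κ·#Q) < 1`. -/
theorem not_nearHomL2BD_of_twoPlane {Λ κ r : ℝ} (hΛ : 1 ≤ Λ) (hΛr : Λ ≤ r)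
    {S Q : Set E3} (hQ : Q.Finite) (hsmall : 8 * Λ ^ 3 * Real.sqrt (κ * nK Q) < 1) {x y : E3} (hx : x ∈ Q) (hy : y ∈ Q)
    (hxS : ∀ p ∈ S, dist p x ≤ Λ + Real.sqrt (κ * nK Q) → p 2 = x 2)
    (hyS : ∀ p ∈ S, dist p y ≤ Λ + Real.sqrt (κ * nK Q) → p 1 = y 1) :
    ¬ NearHomL2BD Λ κ r S Q := fun h =>
  not_nearHomBD_of_twoPlane hΛ hΛr (Real.sqrt_nonneg _) hsmall hx hy hxS hyS (nearHomBD_of_nearHomL2BD hQ h)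

/-- `c10 ≠ 0`. [folklore] -/
theorem c10_ne_zero : c10 ≠ 0 := by
  intro h
  have := congrArg (fun f : E3 => f 2) h
  rw [c10_apply_two, PiLp.zero_apply] at this
  norm_num at this

/-- ★ **(w2) INSTANCE, L² currency**: `{0, c10} ⊂ twoPatch` is not `(2, κ, r)`-near-homogeneous in mean square for `0 ≤ κ < 1/8192`, `r ≥ 2`. -/
theorem not_nearHomL2BD_twoPatch {κ r : ℝ} (hκ : 0 ≤ κ) (hκ' : κ < 1 / 8192) (hr : 2 ≤ r) :
    ¬ NearHomL2BD 2 κ r twoPatch {0, c10} := by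
  have hQ : ({0, c10} : Set E3).Finite := by simp
  have hn : nK ({0, c10} : Set E3) = 2 := by
    simp [nK, Set.ncard_insert_of_notMem, Set.mem_singleton_iff, c10_ne_zero.symm]
  have hs : Real.sqrt (κ * nK ({0, c10} : Set E3)) < 1 / 64 := by
    rw [hn, show (1 : ℝ) / 64 = Real.sqrt ((1 / 64) ^ 2) by rw [Real.sqrt_sq (by norm_num)]]
    exact Real.sqrt_lt_sqrt (by positivity) (by nlinarith)
  have hs0 : 0 ≤ Real.sqrt (κ * nK ({0, c10} : Set E3)) := Real.sqrt_nonneg _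
  exact not_nearHomL2BD_of_twoPlane (by norm_num) hr hQ (by nlinarith) (by simp) (by simp)
    (twoPatch_flat_at_zero (by linarith)) (twoPatch_flat_at_c10 (by linarith))

/-- **(w2) INSTANCE, exact currency**: `twoPatch` is finite, hence not two-periodic and not layered (`not_twoPeriodic_of_finite`). -/
theorem not_twoPeriodic_twoPatch (Λ : ℝ) : ¬ TwoPeriodic Λ twoPatch := not_twoPeriodic_of_finite twoPatch_finite ⟨0, zero_mem_twoPatch⟩

/-- **L1′ in the currency of record — `DoorHomogeneityBD Λ`** (critic row 399 (8): L1′_BD := `DoorHomogeneityBD 2`; typed over the TREE currency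
`OverbindingBudgetLiouvilleDictionary.NearHomBD`, lens-4 p817239, as ruled in row 399 (2)): every door configuration is, at every precision and
every radius, `(Λ; τ, r)`-near ONE homogeneously deformed layered structure. -/
def DoorHomogeneityBD (Λ : ℝ) : Prop :=
  ∀ δ : ℝ, 0 < δ → ∀ τ : ℝ, 0 < τ → ∀ r : ℝ, 0 < r → ∀ S : Set E3, IsDoorSet δ S → NearHomBD Λ τ r S S

/-- **K_A²_BD(Λ, κ) «CleanScaleCoherenceL2BD»** (discrete geometric rigidity for door sets, radius 4; equilibrium-free; critic rows 395 (2)/396 (1)):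
every root window of a door configuration is near ONE layered structure in mean square, chart distortion `≤ Λ`, mean-square deviation `≤ κ`. -/
def CleanScaleCoherenceL2BD (Λ κ : ℝ) : Prop :=
  ∀ δ : ℝ, 0 < δ → ∀ S : Set E3, IsDoorSet δ S → ∀ R : ℝ, 0 < R → NearHomL2BD Λ κ 4 S (atomsIn (μS S) 0 R)

/-- **K_B²_BD(Λ, κ) «FlatnessImprovementL2BD»** (L²-excess decay / perturbative Liouville at excess density `κ`, NEAR conclusion — the verbatim
re-typing ordered in row 399 (3)): window-wise mean-square coherence upgrades to `(Λ; τ, r)`-near-homogeneity of the whole door configuration. -/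
def FlatnessImprovementL2BD (Λ κ : ℝ) : Prop :=
  ∀ δ : ℝ, 0 < δ → ∀ τ : ℝ, 0 < τ → ∀ r : ℝ, 0 < r → ∀ S : Set E3, IsDoorSet δ S →
    (∀ R : ℝ, 0 < R → NearHomL2BD Λ κ 4 S (atomsIn (μS S) 0 R)) → NearHomBD Λ τ r S S

/-- the ordered seam (row 399 (3)): `K_A²_BD(Λ,κ) → K_B²_BD(Λ,κ) → DoorHomogeneityBD Λ`, at EVERY shared `κ`. -/
theorem doorHomogeneityBD_of_L2 {Λ κ : ℝ} (hA : CleanScaleCoherenceL2BD Λ κ) (hB : FlatnessImprovementL2BD Λ κ) :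
    DoorHomogeneityBD Λ :=
  fun δ hδ τ hτ r hr S hS => hB δ hδ τ hτ r hr S hS (fun R hR => hA δ hδ S hS R hR)

/-- L1′_BD gives K_A²_BD(Λ, κ) back for every `κ ≥ 1/256` (no loss on the residual side; restriction of the global chart to the window). -/
theorem cleanScaleCoherenceL2BD_of_doorHomogeneityBD {Λ κ : ℝ} (hκ : 1 / 256 ≤ κ) (h : DoorHomogeneityBD Λ) :
    CleanScaleCoherenceL2BD Λ κ := by
  intro δ hδ S hS R _
  have h1 : NearHomBD Λ (1 / 16) 4 S S := h δ hδ (1 / 16) (by norm_num) 4 (by norm_num) S hS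
  obtain ⟨L, hL, hL', w, Ψ, hinj, hmaps, henv⟩ := h1
  have hsub : atomsIn (μS S) 0 R ⊆ S := fun x hx => by
    have hx' := hx.1
    rwa [Literature.Probability.Process.count_restrict_singleton_ne_zero_iff] at hx'
  have h2 : NearHomBD Λ (1 / 16) 4 S (atomsIn (μS S) 0 R) :=
    ⟨L, hL, hL', w, Ψ, hinj.mono hsub, hmaps.mono_left hsub, fun x hx => henv x (hsub hx)⟩
  exact nearHomL2BD_mono (le_trans (by norm_num) hκ) (nearHomL2BD_of_nearHomBD (by norm_num) h2)

/-! ### 3c. CALIBRATION (w0): the trivial regime of the near currencies is marked by theorem, so no piece is ever read there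
At tolerance `τ ≥ r` the currency of record holds on EVERY countable configuration (chart = identity, any model: match `p ↦ Ψ x` and
`q ↦ x`); hence `NearHomL2BD Λ κ r` is trivial for `κ ≥ r²` and K_A²_BD(Λ, κ) carries content only for `κ < 16` (kernel below) — in fact only
for `κ` below the squared covering radius of a clean configuration (≈ 0.6, not formalised); the non-vacuity witnesses bite at `κ < 1/Λ²` (w1) and
`κ < 1/(64Λ⁶·#Q)` (w2). `DoorHomogeneityBD` / `DoorPeriodic` quantify every `τ > 0` resp. are exact, so they have no trivial regime. -/

/-- an injection of a countable set into layer `0` of any layered model with an invertible chart. -/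
theorem exists_injOn_mapsTo_layeredHom (L : E3 ≃L[ℝ] E3) (w : ℤ → E3) {Q : Set E3} (hQ : Q.Countable) :
    ∃ Ψ : E3 → E3, Set.InjOn Ψ Q ∧ Set.MapsTo Ψ Q (LayeredHom (L : E3 →L[ℝ] E3) w) := by
  obtain ⟨f, hf⟩ := Set.countable_iff_exists_injOn.1 hQ
  refine ⟨fun x => (L : E3 →L[ℝ] E3) (((f x : ℤ) : ℝ) • triangularVec₁ 1 + ((0 : ℤ) : ℝ) • triangularVec₂ 1) + w 0,
    fun x hx y hy hxy => ?_, fun x _ => ⟨0, f x, 0, rfl⟩⟩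
  have ht : triangularVec₁ 1 ≠ 0 := fun h => by
    have h1 := norm_triangularVec₁_one
    rw [h, norm_zero] at h1
    exact zero_ne_one h1
  have h1 : ((f x : ℤ) : ℝ) • triangularVec₁ 1 + ((0 : ℤ) : ℝ) • triangularVec₂ 1 =
      ((f y : ℤ) : ℝ) • triangularVec₁ 1 + ((0 : ℤ) : ℝ) • triangularVec₂ 1 :=
    L.injective (add_right_cancel hxy)
  simp only [Int.cast_zero, zero_smul, add_zero, Int.cast_natCast] at h1
  have h2 : (f x : ℝ) = f y := smul_left_injective ℝ ht h1
  exact hf hx hy (by exact_mod_cast h2)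

/-- **(w0) calibration of the currency of record**: `NearHomBD Λ τ r S Q` is TRIVIAL at tolerance `τ ≥ r` (for `Λ ≥ 1`, `Q ⊆ S` countable). -/
theorem nearHomBD_of_tol_ge {Λ τ r : ℝ} (hΛ : 1 ≤ Λ) (hτ : r ≤ τ) {S Q : Set E3} (hQS : Q ⊆ S) (hQ : Q.Countable) :
    NearHomBD Λ τ r S Q := by
  obtain ⟨Ψ, hinj, hmaps⟩ := exists_injOn_mapsTo_layeredHom (ContinuousLinearEquiv.refl ℝ E3) (fun _ => 0) hQ
  have hid : ‖((ContinuousLinearEquiv.refl ℝ E3 : E3 ≃L[ℝ] E3) : E3 →L[ℝ] E3)‖ ≤ Λ := by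
    rw [ContinuousLinearEquiv.coe_refl]
    exact ContinuousLinearMap.norm_id_le.trans hΛ
  have hid' : ‖((ContinuousLinearEquiv.refl ℝ E3).symm : E3 →L[ℝ] E3)‖ ≤ Λ := by
    rw [ContinuousLinearEquiv.refl_symm]
    exact hid
  refine ⟨ContinuousLinearEquiv.refl ℝ E3, hid, hid', fun _ => 0, Ψ, hinj, hmaps, fun x hx => ⟨?_, ?_⟩⟩
  · intro p _ hp
    refine ⟨Ψ x, hmaps hx, ?_⟩
    rw [sub_self, dist_eq_norm, sub_zero, ← dist_eq_norm]
    exact hp.trans hτ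
  · intro q _ hq
    refine ⟨x, hQS hx, ?_⟩
    rw [sub_self, dist_eq_norm, zero_sub, norm_neg, ← dist_eq_norm]
    exact hq.trans hτ

/-- **(w0) for the L² currency**: `NearHomL2BD Λ κ r S Q` is trivial for `κ ≥ r²` (`r ≥ 0`). -/
theorem nearHomL2BD_of_large {Λ κ r : ℝ} (hΛ : 1 ≤ Λ) (hr : 0 ≤ r) (hκ : r ^ 2 ≤ κ) {S Q : Set E3} (hQS : Q ⊆ S)
    (hQ : Q.Countable) : NearHomL2BD Λ κ r S Q :=
  nearHomL2BD_mono hκ (nearHomL2BD_of_nearHomBD hr (nearHomBD_of_tol_ge hΛ le_rfl hQS hQ))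

/-- **(w0) for K_A²_BD**: `CleanScaleCoherenceL2BD Λ κ` is TRIVIALLY TRUE for `Λ ≥ 1`, `κ ≥ 16` — the piece is read at `κ < 16` only
(and is meant at `κ ≪ 1`); see the MEMO «K_A² as discrete rigidity» for where the equilibrium-free rigidity route lands on this scale. -/
theorem cleanScaleCoherenceL2BD_of_large {Λ κ : ℝ} (hΛ : 1 ≤ Λ) (hκ : 16 ≤ κ) : CleanScaleCoherenceL2BD Λ κ := by
  intro δ hδ S hS R _
  have hsub : atomsIn (μS S) 0 R ⊆ S := fun x hx => by
    have hx' := hx.1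
    rwa [Literature.Probability.Process.count_restrict_singleton_ne_zero_iff] at hx'
  exact nearHomL2BD_of_large hΛ (by norm_num) (le_trans (by norm_num) hκ) hsub
    ((countable_of_isSep hδ hS.2.1).mono hsub)

/-! ### 3b. The EXACT variant (this node's recommendation): K_B²♮ concludes two-periodicity; L1′♮ `DoorPeriodic Λ` -/

/-- **L1′♮ «DoorPeriodic Λ»** (EXACT discrete Liouville for clean charted LJ equilibria, INTRINSIC): every door configuration has two linearly
independent exact periods of length `≤ Λ` — equivalently (`isLayered_iff_twoPeriodic_of_isSep`) IS a homogeneously strained layered crystal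
`Layered a b w` = tree `LayeredHom L w` with independent short in-plane generators and free per-layer translations. -/
def DoorPeriodic (Λ : ℝ) : Prop :=
  ∀ δ : ℝ, 0 < δ → ∀ S : Set E3, IsDoorSet δ S → TwoPeriodic Λ S

/-- **K_B²♮(Λ, κ) «FlatnessExactL2BD»** (L²-excess decay run from infinity INCLUDING the last step «⇒ exactly homogeneous», lens-2 N′ schema (iii)):
window-wise mean-square coherence of a door configuration upgrades to EXACT two-periodicity. -/
def FlatnessExactL2BD (Λ κ : ℝ) : Prop :=
  ∀ δ : ℝ, 0 < δ → ∀ S : Set E3, IsDoorSet δ S → (∀ R : ℝ, 0 < R → NearHomL2BD Λ κ 4 S (atomsIn (μS S) 0 R)) → TwoPeriodic Λ S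

/-- the exact seam: `K_A²_BD(Λ,κ) → K_B²♮(Λ,κ) → DoorPeriodic Λ`. -/
theorem doorPeriodic_of_L2 {Λ κ : ℝ} (hA : CleanScaleCoherenceL2BD Λ κ) (hB : FlatnessExactL2BD Λ κ) : DoorPeriodic Λ :=
  fun δ hδ S hS => hB δ hδ S hS (fun R hR => hA δ hδ S hS R hR)

/-- the model-side reading of L1′♮: every door configuration IS layered. -/
theorem isLayered_of_doorPeriodic {Λ : ℝ} (h : DoorPeriodic Λ) {δ : ℝ} (hδ : 0 < δ) {S : Set E3} (hS : IsDoorSet δ S) : IsLayered Λ S :=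
  (isLayered_iff_twoPeriodic_of_isSep hδ hS.1 hS.2.1).2 (h δ hδ S hS)

/-- monotonicity of the pieces in `Λ`. -/
theorem DoorPeriodic.mono {Λ Λ' : ℝ} (hΛ : Λ ≤ Λ') (h : DoorPeriodic Λ) : DoorPeriodic Λ' :=
  fun δ hδ S hS => (h δ hδ S hS).mono hΛ

/-! ## 4. The split beneath BULK|door in the exact currency: BULK|door ⟸ L1′♮ ∧ HBG″, kernels K0″–K2″, and N's conclusions -/

/-- **HBG″ «PeriodicBulkGapDoor Λ»** = BULK|door's body with the ONE extra hypothesis `TwoPeriodic Λ S` on the door configuration (WEAKER: K1″).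
On a two-periodic configuration site energies and matched-status are constant along each period lattice (translation by a period is a symmetry of
`S`), so this is a LAYER-CHAIN statement (g21 `ChartedPlanarOrderLayerChainLiouville`, census TAG 139′). -/
def PeriodicBulkGapDoor (Λ : ℝ) : Prop :=
  ∀ δ : ℝ, 0 < δ → ∀ θ : ℝ, 0 < θ → θ ≤ 1 / 16 → ∀ u : ℝ, 0 < u → u ≤ 1 →
    ∃ η : ℝ, 0 < η ∧ ∃ C : ℝ, 0 ≤ C ∧ ∃ r : ℝ, 0 < r ∧ ∃ R₀ : ℝ, 1 ≤ R₀ ∧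
      ∀ S : Set E3, IsDoorSet δ S → TwoPeriodic Λ S → ∀ R : ℝ, R₀ ≤ R →
        u * nK (atomsIn (μS S) 0 R) ≤ nBad θ S (atomsIn (μS S) 0 R) →
        η * nK (atomsIn (μS S) 0 R) ≤ excess S (atomsIn (μS S) 0 R) + C * nBdry r S (atomsIn (μS S) 0 R)

/-- **HBG″♭ «PeriodicBulkGap Λ»** — the census-facing, Nash-free and chart-free form: BULK on root windows of rooted, separated, CLEAN, two-periodic
configurations (no `IsNash`, no `IsCharted`; STRONGER than HBG″: `periodicBulkGapDoor_of_periodicBulkGap`, WEAKER than BULK: K0″). -/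
def PeriodicBulkGap (Λ : ℝ) : Prop :=
  ∀ δ : ℝ, 0 < δ → ∀ θ : ℝ, 0 < θ → θ ≤ 1 / 16 → ∀ u : ℝ, 0 < u → u ≤ 1 →
    ∃ η : ℝ, 0 < η ∧ ∃ C : ℝ, 0 ≤ C ∧ ∃ r : ℝ, 0 < r ∧ ∃ R₀ : ℝ, 1 ≤ R₀ ∧
      ∀ S : Set E3, (0 : E3) ∈ S → IsSep δ S → IsClean (μS S) → TwoPeriodic Λ S → ∀ R : ℝ, R₀ ≤ R →
        u * nK (atomsIn (μS S) 0 R) ≤ nBad θ S (atomsIn (μS S) 0 R) →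
        η * nK (atomsIn (μS S) 0 R) ≤ excess S (atomsIn (μS S) 0 R) + C * nBdry r S (atomsIn (μS S) 0 R)

/-- the root window of a rooted separated clean configuration is a clean finite chunk (module A's `isCleanChunk_window` with only the hypotheses used). -/
theorem isCleanChunk_window' {δ : ℝ} (hδ : 0 < δ) {S : Set E3} (hsep : IsSep δ S) (hclean : IsClean (μS S)) (R : ℝ) :
    IsCleanChunk S (atomsIn (μS S) 0 R) := by
  have hatom : ∀ p : E3, (μS S) {p} ≠ 0 ↔ p ∈ S := fun p =>
    Literature.Probability.Process.count_restrict_singleton_ne_zero_iff S p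
  have hKS : atomsIn (μS S) 0 R ⊆ S := fun p hp => (hatom p).1 hp.1
  have hKfin : (atomsIn (μS S) 0 R).Finite := by
    have hf : (Metric.closedBall (0 : E3) R ∩ S).Finite :=
      Literature.Probability.Process.LocalConfig.finite_inter_of_separated hδ hsep (isCompact_closedBall (0 : E3) R)
    exact hf.subset fun p hp => ⟨Metric.mem_closedBall.2 hp.2, (hatom p).1 hp.1⟩
  refine ⟨hKS, hKfin, fun x hx => ?_⟩
  have h1 := hclean x hx.1
  have hset : {p : EuclideanSpace ℝ (Fin 3) | (μS S) {p} ≠ 0} = S := by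
    ext p; exact hatom p
  rw [hset] at h1
  exact h1

/-- **K0″** BULK ⟹ HBG″♭ (restriction; `R₀ = 1`). -/
theorem periodicBulkGap_of_bulk {Λ : ℝ} (hB : BulkDefectGap) : PeriodicBulkGap Λ := by
  intro δ hδ θ hθ hθ' u hu hu1
  obtain ⟨η, hη, C, hC, r, hr, h⟩ := hB δ hδ θ hθ hθ' u hu hu1
  exact ⟨η, hη, C, hC, r, hr, 1, le_rfl, fun S _ hsep hclean _ R _ hd => h S _ hsep (isCleanChunk_window' hδ hsep hclean R) hd⟩

/-- HBG″♭ ⟹ HBG″ (drop `IsNash`, `IsCharted`). -/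
theorem periodicBulkGapDoor_of_periodicBulkGap {Λ : ℝ} (h : PeriodicBulkGap Λ) : PeriodicBulkGapDoor Λ := by
  intro δ hδ θ hθ hθ' u hu hu1
  obtain ⟨η, hη, C, hC, r, hr, R₀, hR₀, h'⟩ := h δ hδ θ hθ hθ' u hu hu1
  exact ⟨η, hη, C, hC, r, hr, R₀, hR₀, fun S hS hP R hR hd => h' S hS.1 hS.2.1 hS.2.2.1 hP R hR hd⟩

/-- **K1″** BULK|door ⟹ HBG″ (drop the periodicity hypothesis: HBG″ is WEAKER-or-equal than the blocker of record). -/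
theorem periodicBulkGapDoor_of_bulkDoor {Λ : ℝ} (h : BulkDefectGapDoor) : PeriodicBulkGapDoor Λ := by
  intro δ hδ θ hθ hθ' u hu hu1
  obtain ⟨η, hη, C, hC, r, hr, R₀, hR₀, h'⟩ := h δ hδ θ hθ hθ' u hu hu1
  exact ⟨η, hη, C, hC, r, hr, R₀, hR₀, fun S hS _ R hR hd => h' S hS R hR hd⟩

/-- hence R⋆ ⟹ HBG″ and BULK ⟹ HBG″. -/
theorem periodicBulkGapDoor_of_bulk {Λ : ℝ} (hB : BulkDefectGap) : PeriodicBulkGapDoor Λ :=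
  periodicBulkGapDoor_of_bulkDoor (bulkDoor_of_bulk hB)

/-- `DiscreteBarlowRigidity ⟹ PeriodicBulkGapDoor Λ` (through BULK|door). [folklore] -/
theorem periodicBulkGapDoor_of_rigidity {Λ : ℝ} (hR : DiscreteBarlowRigidity) : PeriodicBulkGapDoor Λ :=
  periodicBulkGapDoor_of_bulkDoor (bulkDoor_of_rigidity hR)

/-- ★ **K2″ THE CUT: L1′♮ ∧ HBG″ ⟹ BULK|door** (the seam is modus ponens at the shared literal `TwoPeriodic Λ S` — flagged `trivial_seam`; the content
sits in the two pieces). -/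
theorem bulkDoor_of_periodic {Λ : ℝ} (hP : DoorPeriodic Λ) (hG : PeriodicBulkGapDoor Λ) : BulkDefectGapDoor := by
  intro δ hδ θ hθ hθ' u hu hu1
  obtain ⟨η, hη, C, hC, r, hr, R₀, hR₀, h⟩ := hG δ hδ θ hθ hθ' u hu hu1
  exact ⟨η, hη, C, hC, r, hr, R₀, hR₀, fun S hS R hR hd => h S hS (hP δ hδ S hS) R hR hd⟩

/-- ★ **the node at N's registered conclusions, door DISCHARGED (p816932): L1′♮(Λ) ∧ HBG″(Λ) ⟹ VisibleGap (1/50) ∧ PertRegime (1/50)**, for every `Λ`. -/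
theorem gap_and_pert_1_50_of_periodic {Λ : ℝ} (hP : DoorPeriodic Λ) (hG : PeriodicBulkGapDoor Λ) :
    VisibleGap (1 / 50) ∧ PertRegime (1 / 50) :=
  ChartedPlanarOrderDoorDischarged.gap_and_pert_1_50_of_bulkDoor_discharged (bulkDoor_of_periodic hP hG)

/-- the second layer composed: K_A²_BD ∧ K_B²♮ ∧ HBG″ ⟹ GAP(1/50) ∧ PERT(1/50). -/
theorem gap_and_pert_1_50_of_L2_periodic {Λ κ : ℝ} (hA : CleanScaleCoherenceL2BD Λ κ) (hB : FlatnessExactL2BD Λ κ)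
    (hG : PeriodicBulkGapDoor Λ) : VisibleGap (1 / 50) ∧ PertRegime (1 / 50) :=
  gap_and_pert_1_50_of_periodic (doorPeriodic_of_L2 hA hB) hG

/-- and with the census-facing HBG″♭. -/
theorem gap_and_pert_1_50_of_periodic' {Λ : ℝ} (hP : DoorPeriodic Λ) (hG : PeriodicBulkGap Λ) :
    VisibleGap (1 / 50) ∧ PertRegime (1 / 50) :=
  gap_and_pert_1_50_of_periodic hP (periodicBulkGapDoor_of_periodicBulkGap hG)

/-! ## 5. Interface with lens-2 g23: HBG♮(u)_BD over the currency of record (critic rows 396 (3)(iii), 399 (8), 400 (2)(b)) -/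

/-- restriction of a near-homogeneity certificate to a sub-chunk. -/
theorem nearHomBD_restrict {Λ τ r : ℝ} {S Q Q' : Set E3} (h : NearHomBD Λ τ r S Q) (hQ : Q' ⊆ Q) : NearHomBD Λ τ r S Q' := by
  obtain ⟨L, hL, hL', w, Ψ, hinj, hmaps, henv⟩ := h
  exact ⟨L, hL, hL', w, Ψ, hinj.mono hQ, hmaps.mono_left hQ, fun x hx => henv x (hQ hx)⟩

/-- The window atoms of `μS S` are points of `S`. [folklore] -/
theorem atomsIn_subset (S : Set E3) (R : ℝ) : atomsIn (μS S) 0 R ⊆ S := fun x hx => by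
  have hx' := hx.1
  rwa [Literature.Probability.Process.count_restrict_singleton_ne_zero_iff] at hx'

/-- **HBG♮(u)_BD «NearHomBulkGapDenseBD»** — lens-2 g23 `HomCoercivityBD.NearHomBulkGapDenseBD` VERBATIM with the currency of record
(tree `NearHomBD Λ τ r S Q`) substituted for lens-2's four-clause `NearHomBD Λ (δ/2) τ r S Q` (critic row 400 (2)(b): one definition;
lens-2-OWNED content, typed here only to certify the interface): for every distortion `Λ ≥ 1`, separation, tolerance `θ ≤ 1/16`, bad density `u`,
an energy density `η > 0` such that for every slack `ε > 0`, at a homogeneity precision `(τ, r)` and boundary thickness `r′` CHOSEN BY THE PROVER,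
every clean chunk that is `(Λ; τ, r)`-near ONE layered structure and has `θ`-unmatched density `≥ u` has excess `≥ η·#Q − C·#bdry − ε·#Q`. -/
def NearHomBulkGapDenseBD : Prop :=
  ∀ Λ : ℝ, 1 ≤ Λ → ∀ δ : ℝ, 0 < δ → ∀ θ : ℝ, 0 < θ → θ ≤ 1 / 16 → ∀ u : ℝ, 0 < u → u ≤ 1 → ∃ η : ℝ, 0 < η ∧ ∀ ε : ℝ, 0 < ε →
    ∃ τ : ℝ, 0 < τ ∧ ∃ r : ℝ, 0 < r ∧ ∃ C : ℝ, 0 ≤ C ∧ ∃ r' : ℝ, 0 < r' ∧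
      ∀ S Q : Set E3, IsSep δ S → IsCleanChunk S Q → NearHomBD Λ τ r S Q → u * nK Q ≤ nBad θ S Q →
        η * nK Q ≤ excess S Q + C * nBdry r' S Q + ε * nK Q

/-- K0 BULK ⟹ HBG♮(u)_BD (drop the homogeneity hypothesis and the slack). -/
theorem hbgBD_of_bulk (hB : BulkDefectGap) : NearHomBulkGapDenseBD := by
  intro Λ _ δ hδ θ hθ hθ' u hu hu1
  obtain ⟨η, hη, C, hC, r, hr, h⟩ := hB δ hδ θ hθ hθ' u hu hu1
  refine ⟨η, hη, fun ε hε => ⟨1, one_pos, 1, one_pos, C, hC, r, hr, fun S Q hS hQ _ hd => ?_⟩⟩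
  have h1 := h S Q hS hQ hd
  have h2 : 0 ≤ ε * nK Q := mul_nonneg hε.le (nK_nonneg Q)
  linarith

/-- **the HomCut seam in the currency of record**: L1′_BD(Λ) ∧ HBG♮(u)_BD ⟹ BULK|door (`Λ ≥ 1`). -/
theorem bulkDoor_of_homBD {Λ : ℝ} (hΛ : 1 ≤ Λ) (h1 : DoorHomogeneityBD Λ) (hG : NearHomBulkGapDenseBD) : BulkDefectGapDoor := by
  intro δ hδ θ hθ hθ' u hu hu1
  obtain ⟨η, hη, h⟩ := hG Λ hΛ δ hδ θ hθ hθ' u hu hu1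
  obtain ⟨τ, hτ, r, hr, C, hC, r', hr', h'⟩ := h (η / 2) (by positivity)
  refine ⟨η / 2, by positivity, C, hC, r', hr', 1, le_rfl, fun S hS R _ hd => ?_⟩
  have hN : NearHomBD Λ τ r S (atomsIn (μS S) 0 R) := nearHomBD_restrict (h1 δ hδ τ hτ r hr S hS) (atomsIn_subset S R)
  have h2 := h' S _ hS.2.1 (isCleanChunk_window hδ hS R) hN hd
  linarith

/-- ★ the third N branch of record (critic row 399 (8)), door discharged: `DoorHomogeneityBD 2 → HBG♮(u)_BD → VisibleGap (1/50) ∧ PertRegime (1/50)`. -/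
theorem gap_and_pert_1_50_of_homBD (h1 : DoorHomogeneityBD 2) (hG : NearHomBulkGapDenseBD) :
    VisibleGap (1 / 50) ∧ PertRegime (1 / 50) :=
  ChartedPlanarOrderDoorDischarged.gap_and_pert_1_50_of_bulkDoor_discharged (bulkDoor_of_homBD (by norm_num) h1 hG)

/-- and one layer down: `K_A²_BD(2,κ) → K_B²_BD(2,κ) → HBG♮(u)_BD → GAP(1/50) ∧ PERT(1/50)`. -/
theorem gap_and_pert_1_50_of_L2_homBD {κ : ℝ} (hA : CleanScaleCoherenceL2BD 2 κ) (hB : FlatnessImprovementL2BD 2 κ)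
    (hG : NearHomBulkGapDenseBD) : VisibleGap (1 / 50) ∧ PertRegime (1 / 50) :=
  gap_and_pert_1_50_of_homBD (doorHomogeneityBD_of_L2 hA hB) hG

/-- **exact ⟹ near at the level of HBG**: HBG♮(u)_BD implies HBG″♭ restricted… no: the two HBG pieces are NOT comparable by a kernel lemma
(HBG″ quantifies over two-periodic DOOR sets, HBG♮(u)_BD over near-homogeneous clean chunks); both are implied by BULK (K0, K0″) and each closes
N with its own L1′ partner (`gap_and_pert_1_50_of_homBD`, `gap_and_pert_1_50_of_periodic`).  Recorded as a docstring, not a theorem. -/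
theorem hbg_pieces_both_of_bulk {Λ : ℝ} (hB : BulkDefectGap) : NearHomBulkGapDenseBD ∧ PeriodicBulkGap Λ :=
  ⟨hbgBD_of_bulk hB, periodicBulkGap_of_bulk hB⟩

end Summit.AtomisticToContinuum.Crystallization.Theorems.ChartedPlanarOrderDoorLayered

end
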